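import Literature.MathematicalPhysics.QuantumFieldTheory.Balaban1983to89.B9Thm310CommutatorBound389BLoc
import Literature.MathematicalPhysics.QuantumFieldTheory.Balaban1983to89.B9Thm310CommutatorBound389BOfInv

/-!
# `Balaban1983to89.B9Thm310CommutatorBound389BLocOfInv` — T. Bałaban, *Propagators for lattice gauge theories in a background field*, Commun. Math. Phys.
# **99** (1985) 389–434 [Balaban1985BackgroundPropagators], p. 414 «The operator K(h_□)G_□h_□ satisfies the inequality (3.89), hence it is small», p. 413
# «An operator R(X) … is localized in X … and satisfies a bound of the type (3.89)», Thm 3.3 p. 399 and the class (3.35) p. 396: THE `Factors389.fac` SLOT FOR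
# THE FACTORS `K(h_□)G_□h_□` OF (3.105) WITH A j-UNIFORM CONSTANT — E′₃ (`B9Thm310CommutatorBound389BMajorant`) and E′₄ (`B9Thm310CommutatorBound389BOfInv`)
# re-run on E′₂b-loc (`B9Thm310CommutatorBound389BLoc.norm_KhBY_O_hTY_apply_le_loc`): the same block majorants, the constant `theta389B … 0` for a cube of ANY
# level, the three small holonomy data LEVEL-WEIGHTED (sub-row G-B9-LETTERS, module M5.7-est, file E′₄-loc)

statement-level skeleton of published theorems with citation tags; proofs where landed; nothing here is a claim about the Yang–Mills mass gap

PDF held: `paper:balaban1985-cmp99-background-propagators` (journal page = PDF page + 388); pp. 396–399, 404, 409, 413–416 read from the held text layer.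

WHAT THIS FILE IS.  E′₃ ∕ E′₄ serve the field `fac` of `B9Thm310Whole.Factors389` for the family `K(h_□)G_□h_□` of `R` in (3.105) with the summand
`1[a ∈ S′_□]·θ₀·M⁻¹·e^{−δ d(a,a′)}`, `θ₀ = M₂(Σ_j‖b_j‖)·theta389B(…; j)` — honest caveat: with E′₁'s GLOBAL data `θ₀` carries `δ_P·Lʲ` (and the global `δ_K`,
`δ_I` are not `O(1)` on the class).  With E′₂b-loc's LEVEL-WEIGHTED data (print's (3.35)∕(3.69) currency «O(1)Mα₀(Lʲη)⁻² on Ω_j») the same three statements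
hold with `θ₀ = M₂(Σ_j‖b_j‖)·theta389B(…; 0)`, INDEPENDENT of the level of `□` — this is what `conv3107_of_local3107`'s smallness hypothesis
`NF·θ₀·M⁻¹·c₁ ≤ ½` («M sufficiently large», p. 415) can be met with, uniformly in `k`.
* ★★ `hasMajorant_conj_of_bound389BLoc` — E′₃'s `hasMajorant_conj_of_bound389B` with level-weighted `hP`∕`hKc`∕`hI` and the constant at `j = 0`.
* ★★ `norm_KhBY_hTY_apply_le_of_eBlockInvB_loc` (A), ★★ `hasMajorant_conj_KhBY_hTY_of_eBlockInvB_loc` (B), ★★★ `hasMajorant_conj_KhBY_hTY_of_eBlockInvB_fac_loc`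
  (C) — E′₄'s three compositions with the bond-sector dictionary `B9CubeLettersInvReadDictB` (the (3.42) block `EBlock (kernelFamilyBInv i B cfg O par) B₀ δ U₁`
  of the cube letter `O` serves `h342₀`∕`h342₁`), level-weighted data, constant `theta389B … 0`; (C) is the LITERAL `Factors389.fac` summand shape
  `1[a ∈ S′]·θ₀·((geo9K i).M)⁻¹·e^{−δ d(a,a′)}` with `θ₀ = M₂(Σ_j‖b_j‖)·theta389B d ℓ B₀ b₁ δ ρ δ_P δ_K δ_I 0`.
HONEST SCOPE.  As E′₂b-loc ∕ E′₃ ∕ E′₄: the (3.42) block of `O` and the three level-weighted holonomy data are HYPOTHESES (the reading of the data off the class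
`bg9KP.Reg335` is a successor file); nothing of Thm 3.3 ∕ 3.10 is asserted; the sets `S′_□` and their overlap count are the glue's static data; same rate `δ`;
corner-free members; `η = |c_f|⁻¹`; nothing landed is modified; nothing continuum ∕ OS ∕ mass gap ∕ Clay; YM mass gap NOT proved by any of this (Track A
conditional rung).  `--supports stmt-QuantumFields-19200`.  Net new unproved facts: 0.
-/

noncomputable section

namespace Literature.MathematicalPhysics.QuantumFieldTheory.Balaban1983to89.B9Thm310CommutatorBound389BLocOfInv

open Node00 B9CubeLettersInvReadings
open B9Thm37CubeCoverCommutators (cutMulY hTY)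
open B9Thm37CubeCoverCommutatorSizes (side_conditions)
open B9Eq3104CutoffCommutators (hBdY KhBY)
open B9Eq3104CommutatorSupport (exists_hT_ne_zero_near_of_KhBY_hTY_ne_zero)
open B9Thm310CommutatorBound389B (theta389B theta389B_nonneg b1_pos)
open B9Thm310CommutatorBound389BLoc (norm_KhBY_O_hTY_apply_le_loc)
open B9Thm310CommutatorBound389BMajorant (hasMajorant_conj_of_ball_boundB smul_comm_of_eq_KhBY norm_liftY_le_abs)
open B9CubeLettersInvReadDictB (h342₀_of_eBlockInvB h342₁_of_eBlockInvB)
open B6KLevelCensusIndexV1 (KIdx)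
open B6Ineq2142KLevelV1 (β)
open B6GlobalChartV1 (blkV1)
open B6Geom246MultiLevelBox (bset blkOf)
open B6Geom246MultiLevelTorus (bondT)
open B6Cover236MultiLevelBlocks (cubes)
open B6RandomWalk (HasMajorant hasMajorant_mono)
open B9Thm34Ext (toB6)
open B9FromB6 (EBlock)
open B9GeoNormsKLevelV1 (geo9K)
open B9Eq352DivFormLetters (conj)
open Node00.OpsYNablaBridge (chartY)
open B9Eq39Adjoint (R plaqU)
open B9Eq3104CommutatorSizesCurl (jIns)
open scoped Matrix

variable {𝔸 : Type} [NormedRing 𝔸] [NormedAlgebra ℂ 𝔸] [CompleteSpace 𝔸]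
variable {d ℓ : ℕ} {hd : 1 ≤ d + 1} {hL : Odd (ℓ + 1) ∧ 1 < ℓ + 1} {b₀ b₁ : ℝ}
variable {ι : Type} [Fintype ι]
variable (i : KIdx d ℓ hd hL b₀ b₁) (b : Module.Basis ι ℝ 𝔸)

/-! ## §1 The `Factors389.fac`-shaped majorant from E′₂b-loc (E′₃ re-run) -/

section Majorant

variable [Fintype (geo9K i).Site] {Rr : ℝ} {Hp : Prop}

/-- ★★ **THE `Factors389.fac` SLOT FOR THE FACTORS `K(h_□)G_□h_□` OF (3.105), j-UNIFORM** — E′₃'s `hasMajorant_conj_of_bound389B` with the three small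
holonomy data LEVEL-WEIGHTED (E′₂b-loc's `hP`, `hKc`, `hI`): for ANY bond cube letter `O` at `U` with Thm 3.3's value ∕ gradient entries displayed (`h342₀`,
`h342₁`), an ℝ-linear `Rl` with `Rl Λ = K(h_□)(U)(O(h_□Λ))`, a real basis `b` (coordinate bound `M₂`) and any finset `S′ ⊇ {a : βa within 2ℓ + 6 of supp h_□}`:
`conj b Rl` has the block majorant `1[a ∈ S′]·M₂(Σ_j‖b_j‖)·θ₃₈₉ᴮ(…; 0)∕(L·M_h)·e^{−δ d(a,a′)}` w.r.t. `(x, j) ↦ ιB(Δ(x₋))` — the constant independent of the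
level of `□`. [cite: Balaban1985BackgroundPropagators, p.413 («localized in X … satisfies a bound of the type (3.89)»), (3.105) p.414, (3.89) p.409, (3.35) p.396; Balaban1984PropagatorsII, (2.51) p.232] -/
theorem hasMajorant_conj_of_bound389BLoc (c : ↥(cubes i.D.toDomains)) (parB : BondParY 𝔸 i) (U : CfgY 𝔸 i)
    (O : (FBondY i → 𝔸) →ₗ[ℂ] (FBondY i → 𝔸)) {B₀ δ : ℝ} (hB₀ : 0 ≤ B₀) (hδ : 0 ≤ δ)
    (hη : etaS i = |i.cf|⁻¹) (ιB : BlkY i → IBondY i) (hι : ∀ s, β i.hN i.D i.hk (ιB s) = s)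
    (hU : ∀ μ x, ‖(U μ x : 𝔸)‖ ≤ 1 ∧ ‖(((U μ x)⁻¹ : 𝔸ˣ) : 𝔸)‖ ≤ 1)
    (hT : ∀ (y : IBondY i) (f : FBondY i), ‖(qT i parB U y f : 𝔸)‖ ≤ 1 ∧ ‖(((qT i parB U y f)⁻¹ : 𝔸ˣ) : 𝔸)‖ ≤ 1)
    {δP ρ δK δI : ℝ} (hδP : 0 ≤ δP) (hρ : 0 ≤ ρ) (hδK : 0 ≤ δK) (hδI : 0 ≤ δI)
    (hP : ∀ (μ lam : Fin (d + 1)) (w : SiteY i) (Y : 𝔸),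
      ‖R (plaqU (shiftY i) (UboxY i U) μ lam w) Y - Y‖ ≤ δP * ((((ℓ : ℝ) + 1) ^ levY i w)⁻¹) ^ 2 * ‖Y‖)
    (hRe : ∀ p : PlaqY i, ‖reHolY i U p‖ ≤ ρ)
    (hKc : ∀ a e (μ : Fin (d + 1)) (x : SiteY i) (Z : 𝔸),
      ‖R (UboxY i U μ ((shiftY i μ).symm x))⁻¹ (jIns i U a e ((shiftY i μ).symm x) (R (UboxY i U μ ((shiftY i μ).symm x)) Z)) - jIns i U a e x Z‖
        ≤ δK * |i.cf| * ((((ℓ : ℝ) + 1) ^ levY i x)⁻¹) ^ 2 * ‖Z‖)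
    (hI : ∀ p : PlaqY i, ‖((i.cf ^ 2 : ℝ) : ℂ) • imHolY i U p‖ ≤ δI * i.cf ^ 2 * ((((ℓ : ℝ) + 1) ^ levY i (chartY i p.src))⁻¹) ^ 2)
    (h342₀ : ∀ (J : FBondY i → ℝ) (y y' : IBondY i), (geo9K i).suppIn (Sum.inr J) y' →
      ∀ Λ : FBondY i → 𝔸, (∀ x, ‖Λ x‖ ≤ |J x|) → ∀ x : FBondY i, blkV1 i.hN i.D x = β i.hN i.D i.hk y →
        ‖O Λ x‖ ≤ B₀ * (geo9K i).len y ^ 2 * Real.exp (-(δ * (geo9K i).dist y y')) * (geo9K i).supNorm (Sum.inr J))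
    (h342₁ : ∀ (J : FBondY i → ℝ) (y y' : IBondY i), (geo9K i).suppIn (Sum.inr J) y' →
      ∀ Λ : FBondY i → 𝔸, (∀ x, ‖Λ x‖ ≤ |J x|) → ∀ (x : FBondY i) (ν : Fin (d + 1)), blkV1 i.hN i.D x = β i.hN i.D i.hk y →
        ‖cdB i U ν (O Λ) x‖ ≤ B₀ * (geo9K i).len y * Real.exp (-(δ * (geo9K i).dist y y')) * (geo9K i).supNorm (Sum.inr J))
    {M₂ : ℝ} (hM₂ : 0 ≤ M₂) (hrepr : ∀ (v : 𝔸) (j : ι), |b.repr v j| ≤ M₂ * ‖v‖)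
    (Rl : Module.End ℝ (FBondY i → 𝔸)) (hRl : ∀ Λ, Rl Λ = KhBY i (hTY i c) parB U (O (cutMulY (hBdY i (hTY i c)) Λ)))
    (S' : Finset (IBondY i))
    (hS' : ∀ a : IBondY i, (∃ u : SiteY i, hTY i c u ≠ 0 ∧ ((bondT i.D).dist (β i.hN i.D i.hk a) (blkOf i.D.toDomains u) : ℝ) ≤ 2 * (ℓ : ℝ) + 6) →
      a ∈ S') :
    HasMajorant (g := toB6 (geo9K i) Rr Hp) (fun p : FBondY i × ι => ιB (blkV1 i.hN i.D p.1)) (conj b Rl)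
      (fun a a' => if a ∈ S' then M₂ * (∑ j, ‖b j‖) * (theta389B d ℓ B₀ b₁ δ ρ δP δK δI 0 / (((ℓ : ℝ) + 1) * i.Mh))
        * Real.exp (-(δ * (geo9K i).dist a a')) else 0) := by
  classical
  obtain ⟨_, hMh2, _, _⟩ := side_conditions i
  have hθ : ∀ a : IBondY i, 0 ≤ theta389B d ℓ B₀ b₁ δ ρ δP δK δI 0 / (((ℓ : ℝ) + 1) * i.Mh) := fun a =>
    div_nonneg (theta389B_nonneg d ℓ hB₀ (b1_pos i a).le hρ hδP hδK hδI δ _) (by positivity)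
  have hW : ∀ a a' : IBondY i,
      0 ≤ (if a ∈ S' then theta389B d ℓ B₀ b₁ δ ρ δP δK δI 0 / (((ℓ : ℝ) + 1) * i.Mh) * Real.exp (-(δ * (geo9K i).dist a a')) else 0) :=
    fun a a' => by
      split_ifs
      · exact mul_nonneg (hθ a) (Real.exp_pos _).le
      · exact le_rfl
  have hTW : ∀ (J : FBondY i → ℝ) (y y' : IBondY i), (geo9K i).suppIn (Sum.inr J) y' → ∀ E : 𝔸, ‖E‖ ≤ 1 →
      ∀ x : FBondY i, blkV1 i.hN i.D x = β i.hN i.D i.hk y → ‖Rl (liftY J E) x‖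
        ≤ (if y ∈ S' then theta389B d ℓ B₀ b₁ δ ρ δP δK δI 0 / (((ℓ : ℝ) + 1) * i.Mh) * Real.exp (-(δ * (geo9K i).dist y y')) else 0)
          * (geo9K i).supNorm (Sum.inr J) := by
    intro J y y' hs E hE x hx
    rw [hRl]
    by_cases hy : y ∈ S'
    · rw [if_pos hy]
      exact norm_KhBY_O_hTY_apply_le_loc i c parB U O hB₀ hδ hη ιB hι hU hT hδP hρ hδK hδI hP hRe hKc hI h342₀ h342₁ J y y' hs (liftY J E)
        (norm_liftY_le_abs i J hE) x hx
    · -- off `S′` the letter vanishes on the block `Δ(βy)` (output localisation, E′₂a)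
      have h0 : KhBY i (hTY i c) parB U (O (cutMulY (hBdY i (hTY i c)) (liftY J E))) x = 0 := by
        by_contra hne
        obtain ⟨u, hu, hdist⟩ := exists_hT_ne_zero_near_of_KhBY_hTY_ne_zero i c parB U _ x hne
        rw [hx] at hdist
        exact hy (hS' y ⟨u, hu, hdist⟩)
      rw [h0, norm_zero, if_neg hy, zero_mul]
  have h := hasMajorant_conj_of_ball_boundB (Rr := Rr) (Hp := Hp) i b Rl (smul_comm_of_eq_KhBY i c parB U O Rl hRl) ιB hι hM₂ hrepr
    (fun a a' => if a ∈ S' then theta389B d ℓ B₀ b₁ δ ρ δP δK δI 0 / (((ℓ : ℝ) + 1) * i.Mh) * Real.exp (-(δ * (geo9K i).dist a a')) else 0)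
    hW hTW
  refine hasMajorant_mono (g := toB6 (geo9K i) Rr Hp) _ h fun a a' => le_of_eq ?_
  show M₂ * (∑ j, ‖b j‖) * (if a ∈ S' then theta389B d ℓ B₀ b₁ δ ρ δP δK δI 0 / (((ℓ : ℝ) + 1) * i.Mh)
      * Real.exp (-(δ * (geo9K i).dist a a')) else 0) = _
  split_ifs
  · ring
  · rw [mul_zero]

end Majorant

/-! ## §2 The cube letter given by its (3.42) block over the invariant class (E′₄ re-run) -/

section OfInv

variable {B : B9.Backgrounds} (cfg : B.Cfg → CfgY 𝔸 i) (O : BondOpY 𝔸 i) (par : BondParY 𝔸 i) {B₀ δ : ℝ} {U₁ : B.Cfg}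

/-- ★★ **(A) THE BOND-SECTOR (3.89) FOR `K(h_□)G_□(U)h_□`, `G_□` GIVEN BY ITS THM-3.3 BLOCK OVER THE INVARIANT CLASS, j-UNIFORM** — E′₄ (A) with the three
small holonomy data LEVEL-WEIGHTED: `‖(K(h_□)(U)(O(U)(h_□Λ)))(x)‖ ≤ θ₃₈₉ᴮ(…; 0)∕((ℓ+1)·M_h)·e^{−δ d(y,y′)}·|J|` for `x ∈ Δ(y)`, `supp J ⊂ Δ(y′)`, `‖Λ‖ ≤ |J|`.
[cite: Balaban1985BackgroundPropagators, p.414 («satisfies the inequality (3.89), hence it is small»), (3.89) p.409, Thm 3.3 p.399 with (3.42) p.397, (3.35) p.396; Balaban1984PropagatorsII, (2.44) p.230] -/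
theorem norm_KhBY_hTY_apply_le_of_eBlockInvB_loc (hE : EBlock (kernelFamilyBInv i B cfg O par) B₀ δ U₁)
    {M₂ : ℝ} (hM₂ : 0 ≤ M₂) (hrepr : ∀ (v : 𝔸) (j : ι), |b.repr v j| ≤ M₂ * ‖v‖)
    (c : ↥(cubes i.D.toDomains)) (parB : BondParY 𝔸 i) (hB₀ : 0 ≤ B₀) (hδ : 0 ≤ δ)
    (hη : etaS i = |i.cf|⁻¹) (ιB : BlkY i → IBondY i) (hι : ∀ s, β i.hN i.D i.hk (ιB s) = s)
    (hU : ∀ μ x, ‖(cfg U₁ μ x : 𝔸)‖ ≤ 1 ∧ ‖(((cfg U₁ μ x)⁻¹ : 𝔸ˣ) : 𝔸)‖ ≤ 1)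
    (hT : ∀ (y : IBondY i) (f : FBondY i), ‖(qT i parB (cfg U₁) y f : 𝔸)‖ ≤ 1 ∧ ‖(((qT i parB (cfg U₁) y f)⁻¹ : 𝔸ˣ) : 𝔸)‖ ≤ 1)
    {δP ρ δK δI : ℝ} (hδP : 0 ≤ δP) (hρ : 0 ≤ ρ) (hδK : 0 ≤ δK) (hδI : 0 ≤ δI)
    (hP : ∀ (μ lam : Fin (d + 1)) (w : SiteY i) (Y : 𝔸),
      ‖R (plaqU (shiftY i) (UboxY i (cfg U₁)) μ lam w) Y - Y‖ ≤ δP * ((((ℓ : ℝ) + 1) ^ levY i w)⁻¹) ^ 2 * ‖Y‖)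
    (hRe : ∀ p : PlaqY i, ‖reHolY i (cfg U₁) p‖ ≤ ρ)
    (hKc : ∀ a e (μ : Fin (d + 1)) (x : SiteY i) (Z : 𝔸),
      ‖R (UboxY i (cfg U₁) μ ((shiftY i μ).symm x))⁻¹ (jIns i (cfg U₁) a e ((shiftY i μ).symm x) (R (UboxY i (cfg U₁) μ ((shiftY i μ).symm x)) Z))
        - jIns i (cfg U₁) a e x Z‖ ≤ δK * |i.cf| * ((((ℓ : ℝ) + 1) ^ levY i x)⁻¹) ^ 2 * ‖Z‖)
    (hI : ∀ p : PlaqY i, ‖((i.cf ^ 2 : ℝ) : ℂ) • imHolY i (cfg U₁) p‖ ≤ δI * i.cf ^ 2 * ((((ℓ : ℝ) + 1) ^ levY i (chartY i p.src))⁻¹) ^ 2)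
    (J : FBondY i → ℝ) (y y' : IBondY i) (hs : (geo9K i).suppIn (Sum.inr J) y')
    (Λ : FBondY i → 𝔸) (hΛ : ∀ x, ‖Λ x‖ ≤ |J x|) (x : FBondY i) (hx : blkV1 i.hN i.D x = β i.hN i.D i.hk y) :
    ‖KhBY i (hTY i c) parB (cfg U₁) (O (cfg U₁) (cutMulY (hBdY i (hTY i c)) Λ)) x‖
      ≤ theta389B d ℓ B₀ b₁ δ ρ δP δK δI 0 / (((ℓ : ℝ) + 1) * i.Mh) * Real.exp (-(δ * (geo9K i).dist y y'))
          * (geo9K i).supNorm (Sum.inr J) :=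
  norm_KhBY_O_hTY_apply_le_loc i c parB (cfg U₁) (O (cfg U₁)) hB₀ hδ hη ιB hι hU hT hδP hρ hδK hδI hP hRe hKc hI
    (h342₀_of_eBlockInvB i b cfg O par hE hM₂ hrepr) (h342₁_of_eBlockInvB i b cfg O par hE hM₂ hrepr) J y y' hs Λ hΛ x hx

variable [Fintype (geo9K i).Site] {Rr : ℝ} {Hp : Prop}

/-- ★★ **(B) THE `Factors389.fac` SLOT FOR `K(h_□)G_□(U)h_□`, `G_□` GIVEN BY ITS THM-3.3 BLOCK OVER THE INVARIANT CLASS, j-UNIFORM** — E′₄ (B) with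
level-weighted holonomy data: `conj b Rl` has the block majorant `1[a ∈ S′]·M₂(Σ_j‖b_j‖)·θ₃₈₉ᴮ(…; 0)∕((ℓ+1)·M_h)·e^{−δ d(a,a′)}` w.r.t. `(x, j) ↦ ιB(Δ(x))`.
[cite: Balaban1985BackgroundPropagators, p.413 («localized in X … satisfies a bound of the type (3.89)»), (3.105) p.414, (3.89) p.409, Thm 3.3 p.399, (3.35) p.396; Balaban1984PropagatorsII, (2.44) p.230, (2.51) p.232] -/
theorem hasMajorant_conj_KhBY_hTY_of_eBlockInvB_loc (hE : EBlock (kernelFamilyBInv i B cfg O par) B₀ δ U₁)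
    {M₂ : ℝ} (hM₂ : 0 ≤ M₂) (hrepr : ∀ (v : 𝔸) (j : ι), |b.repr v j| ≤ M₂ * ‖v‖)
    (c : ↥(cubes i.D.toDomains)) (parB : BondParY 𝔸 i) (hB₀ : 0 ≤ B₀) (hδ : 0 ≤ δ)
    (hη : etaS i = |i.cf|⁻¹) (ιB : BlkY i → IBondY i) (hι : ∀ s, β i.hN i.D i.hk (ιB s) = s)
    (hU : ∀ μ x, ‖(cfg U₁ μ x : 𝔸)‖ ≤ 1 ∧ ‖(((cfg U₁ μ x)⁻¹ : 𝔸ˣ) : 𝔸)‖ ≤ 1)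
    (hT : ∀ (y : IBondY i) (f : FBondY i), ‖(qT i parB (cfg U₁) y f : 𝔸)‖ ≤ 1 ∧ ‖(((qT i parB (cfg U₁) y f)⁻¹ : 𝔸ˣ) : 𝔸)‖ ≤ 1)
    {δP ρ δK δI : ℝ} (hδP : 0 ≤ δP) (hρ : 0 ≤ ρ) (hδK : 0 ≤ δK) (hδI : 0 ≤ δI)
    (hP : ∀ (μ lam : Fin (d + 1)) (w : SiteY i) (Y : 𝔸),
      ‖R (plaqU (shiftY i) (UboxY i (cfg U₁)) μ lam w) Y - Y‖ ≤ δP * ((((ℓ : ℝ) + 1) ^ levY i w)⁻¹) ^ 2 * ‖Y‖)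
    (hRe : ∀ p : PlaqY i, ‖reHolY i (cfg U₁) p‖ ≤ ρ)
    (hKc : ∀ a e (μ : Fin (d + 1)) (x : SiteY i) (Z : 𝔸),
      ‖R (UboxY i (cfg U₁) μ ((shiftY i μ).symm x))⁻¹ (jIns i (cfg U₁) a e ((shiftY i μ).symm x) (R (UboxY i (cfg U₁) μ ((shiftY i μ).symm x)) Z))
        - jIns i (cfg U₁) a e x Z‖ ≤ δK * |i.cf| * ((((ℓ : ℝ) + 1) ^ levY i x)⁻¹) ^ 2 * ‖Z‖)
    (hI : ∀ p : PlaqY i, ‖((i.cf ^ 2 : ℝ) : ℂ) • imHolY i (cfg U₁) p‖ ≤ δI * i.cf ^ 2 * ((((ℓ : ℝ) + 1) ^ levY i (chartY i p.src))⁻¹) ^ 2)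
    (Rl : Module.End ℝ (FBondY i → 𝔸)) (hRl : ∀ Λ, Rl Λ = KhBY i (hTY i c) parB (cfg U₁) (O (cfg U₁) (cutMulY (hBdY i (hTY i c)) Λ)))
    (S' : Finset (IBondY i))
    (hS' : ∀ a : IBondY i, (∃ u : SiteY i, hTY i c u ≠ 0 ∧ ((bondT i.D).dist (β i.hN i.D i.hk a) (blkOf i.D.toDomains u) : ℝ) ≤ 2 * (ℓ : ℝ) + 6) →
      a ∈ S') :
    HasMajorant (g := toB6 (geo9K i) Rr Hp) (fun p : FBondY i × ι => ιB (blkV1 i.hN i.D p.1)) (conj b Rl)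
      (fun a a' => if a ∈ S' then M₂ * (∑ j, ‖b j‖) * (theta389B d ℓ B₀ b₁ δ ρ δP δK δI 0 / (((ℓ : ℝ) + 1) * i.Mh))
        * Real.exp (-(δ * (geo9K i).dist a a')) else 0) :=
  hasMajorant_conj_of_bound389BLoc i b c parB (cfg U₁) (O (cfg U₁)) hB₀ hδ hη ιB hι hU hT hδP hρ hδK hδI hP hRe hKc hI
    (h342₀_of_eBlockInvB i b cfg O par hE hM₂ hrepr) (h342₁_of_eBlockInvB i b cfg O par hE hM₂ hrepr) hM₂ hrepr Rl hRl S' hS'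

/-- ★★★ **(C) THE SAME MAJORANT IN THE GLUE'S LITERAL `Factors389.fac` SUMMAND SHAPE, j-UNIFORM**: `1[a ∈ S′]·θ₀·M⁻¹·e^{−δ d(a,a′)}`, `M = (geo9K i).M
= (ℓ+1)·M_h`, `θ₀ = M₂(Σ_j‖b_j‖)·θ₃₈₉ᴮ(…; 0)` — the SAME `θ₀` for the cubes of every level, so that the glue's «M sufficiently large» smallness
`NF·θ₀·M⁻¹·c₁ ≤ ½` (p. 415) is ONE condition on `M`, uniformly in `k`.
[cite: Balaban1985BackgroundPropagators, p.413 («satisfies a bound of the type (3.89)»), (3.105) p.414, p.415, (3.89) p.409 («O(M⁻¹)e^{−δ₀(Lʲη)⁻¹|y−y′|}»), (3.35) p.396; Balaban1984PropagatorsII, (2.44) p.230, (2.51) p.232] -/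
theorem hasMajorant_conj_KhBY_hTY_of_eBlockInvB_fac_loc (hE : EBlock (kernelFamilyBInv i B cfg O par) B₀ δ U₁)
    {M₂ : ℝ} (hM₂ : 0 ≤ M₂) (hrepr : ∀ (v : 𝔸) (j : ι), |b.repr v j| ≤ M₂ * ‖v‖)
    (c : ↥(cubes i.D.toDomains)) (parB : BondParY 𝔸 i) (hB₀ : 0 ≤ B₀) (hδ : 0 ≤ δ)
    (hη : etaS i = |i.cf|⁻¹) (ιB : BlkY i → IBondY i) (hι : ∀ s, β i.hN i.D i.hk (ιB s) = s)
    (hU : ∀ μ x, ‖(cfg U₁ μ x : 𝔸)‖ ≤ 1 ∧ ‖(((cfg U₁ μ x)⁻¹ : 𝔸ˣ) : 𝔸)‖ ≤ 1)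
    (hT : ∀ (y : IBondY i) (f : FBondY i), ‖(qT i parB (cfg U₁) y f : 𝔸)‖ ≤ 1 ∧ ‖(((qT i parB (cfg U₁) y f)⁻¹ : 𝔸ˣ) : 𝔸)‖ ≤ 1)
    {δP ρ δK δI : ℝ} (hδP : 0 ≤ δP) (hρ : 0 ≤ ρ) (hδK : 0 ≤ δK) (hδI : 0 ≤ δI)
    (hP : ∀ (μ lam : Fin (d + 1)) (w : SiteY i) (Y : 𝔸),
      ‖R (plaqU (shiftY i) (UboxY i (cfg U₁)) μ lam w) Y - Y‖ ≤ δP * ((((ℓ : ℝ) + 1) ^ levY i w)⁻¹) ^ 2 * ‖Y‖)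
    (hRe : ∀ p : PlaqY i, ‖reHolY i (cfg U₁) p‖ ≤ ρ)
    (hKc : ∀ a e (μ : Fin (d + 1)) (x : SiteY i) (Z : 𝔸),
      ‖R (UboxY i (cfg U₁) μ ((shiftY i μ).symm x))⁻¹ (jIns i (cfg U₁) a e ((shiftY i μ).symm x) (R (UboxY i (cfg U₁) μ ((shiftY i μ).symm x)) Z))
        - jIns i (cfg U₁) a e x Z‖ ≤ δK * |i.cf| * ((((ℓ : ℝ) + 1) ^ levY i x)⁻¹) ^ 2 * ‖Z‖)
    (hI : ∀ p : PlaqY i, ‖((i.cf ^ 2 : ℝ) : ℂ) • imHolY i (cfg U₁) p‖ ≤ δI * i.cf ^ 2 * ((((ℓ : ℝ) + 1) ^ levY i (chartY i p.src))⁻¹) ^ 2)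
    (Rl : Module.End ℝ (FBondY i → 𝔸)) (hRl : ∀ Λ, Rl Λ = KhBY i (hTY i c) parB (cfg U₁) (O (cfg U₁) (cutMulY (hBdY i (hTY i c)) Λ)))
    (S' : Finset (IBondY i))
    (hS' : ∀ a : IBondY i, (∃ u : SiteY i, hTY i c u ≠ 0 ∧ ((bondT i.D).dist (β i.hN i.D i.hk a) (blkOf i.D.toDomains u) : ℝ) ≤ 2 * (ℓ : ℝ) + 6) →
      a ∈ S') :
    HasMajorant (g := toB6 (geo9K i) Rr Hp) (fun p : FBondY i × ι => ιB (blkV1 i.hN i.D p.1)) (conj b Rl)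
      (fun a a' => if a ∈ S' then M₂ * (∑ j, ‖b j‖) * theta389B d ℓ B₀ b₁ δ ρ δP δK δI 0 * ((geo9K i).M)⁻¹
        * Real.exp (-(δ * (geo9K i).dist a a')) else 0) := by
  have hMdef : (geo9K i).M = (((ℓ + 1 : ℕ) : ℝ)) * (i.Mh : ℝ) := rfl
  refine hasMajorant_mono (g := toB6 (geo9K i) Rr Hp) _
    (hasMajorant_conj_KhBY_hTY_of_eBlockInvB_loc i b cfg O par hE hM₂ hrepr c parB hB₀ hδ hη ιB hι hU hT hδP hρ hδK hδI hP hRe hKc hI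
      Rl hRl S' hS') fun a a' => le_of_eq ?_
  show (if a ∈ S' then M₂ * (∑ j, ‖b j‖) * (theta389B d ℓ B₀ b₁ δ ρ δP δK δI 0 / (((ℓ : ℝ) + 1) * i.Mh))
      * Real.exp (-(δ * (geo9K i).dist a a')) else 0) =
    (if a ∈ S' then M₂ * (∑ j, ‖b j‖) * theta389B d ℓ B₀ b₁ δ ρ δP δK δI 0 * ((geo9K i).M)⁻¹
      * Real.exp (-(δ * (geo9K i).dist a a')) else 0)
  split_ifs
  · rw [hMdef, div_eq_mul_inv]
    push_cast
    ring
  · rfl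

end OfInv

end Literature.MathematicalPhysics.QuantumFieldTheory.Balaban1983to89.B9Thm310CommutatorBound389BLocOfInv

end
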